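import Mathlib
import HarnessLib

/-!
# Index bound by coordinates: `#(D/F) ≤ t^N` when `D/F` embeds coordinatewise into `N` groups of order `≤ t`
# (crux ♭T≤ stmt-BirchSwinnertonDyer-23042, line `sigmacongruence`, stub R1 `stub_relaxedImageCount`, steps (c) and (d) of the relaxed count road)

Width prover `bsd-wall-utd-p1-w2` g3 under lead `bsd-wall-utd-p1` g18 (`--supports stmt-BirchSwinnertonDyer-23042`, helper).
PURE ALGEBRA (Mathlib only); THEOREMS ONLY. BSD is not proved by any of this.

Both the image count (c) (`#(H¹_𝓓/H¹_𝓕) ≤ t_v^{p^c}`: `H¹_𝓓/H¹_𝓕 ↪ ∏_{i<p^c} ker(H¹(Γ_m ∩ D_v, A) → H¹(kerD, A))`, each kernel of order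
`≤ t_v` by `…TowerDescentIndex` / `…LayerDescentKernelIndex`) and the dual term (d) (`#(Y/Y★) ≤ t^{p^c}` via
`ρ : Y → (Fin p^c → ker(H¹(kerD, M) → H¹(kerD, A)))`, `…RelaxedLocalLevelShift.natCard_ker_torsionToPrimary_kerD_le`) of the lead's memo
(`Cruxes/DefectTransportModThreePT/Lines/sigmacongruence-relaxed-count-road.md` §2) have the shape:

* `natCard_range_le_prod_of_apply_mem` — an additive map `ρ : D → (Fin N → Y)` with `ρ x i ∈ S i` (finite subgroups `S i`) has
  `#range ρ ≤ ∏ i, #S i`;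
* `natCard_quotient_ker_le_pow` — hence `#(D / ker ρ) ≤ t^N` if `#S i ≤ t` for all `i`;
* **`natCard_quotient_le_pow_of_ker_le`** — and `#(D / F) ≤ t^N` for every subgroup `F ⊇ ker ρ` (i.e. `ρ x = 0 ⇒ x ∈ F`), with `D ⧸ F` finite;
* `natCard_quotient_addSubgroupOf_le_pow` — the same for nested subgroups `F ≤ D` of an ambient group `G` and `ρ` defined on `D`
  (the currency of the Selmer-group indices `#(H¹_𝓓 / H¹_𝓕)`).

References: [GreenbergVatsal2000] §2 pp. 24–25 (the finite-index bookkeeping); folklore.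
-/

-- `…BirchSwinnertonDyer.BirchSwinnertonDyer…` is the problem's mandated namespace (D-0017 nested layout)
set_option linter.dupNamespace false
set_option autoImplicit false

namespace Summit.BirchSwinnertonDyer.BirchSwinnertonDyer.Theorems.UniversalToricDescentQuotientBoundByCoordinates

variable {D : Type*} [AddCommGroup D] {Y : Type*} [AddCommGroup Y] {N : ℕ}

/-- `#range ρ ≤ ∏ i, #S i` for `ρ : D →+ (Fin N → Y)` with coordinates in finite subgroups `S i`. [folklore] -/
theorem natCard_range_le_prod_of_apply_mem (ρ : D →+ (Fin N → Y)) (S : Fin N → AddSubgroup Y)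
    (hS : ∀ x i, ρ x i ∈ S i) [∀ i, Finite (S i)] :
    Finite ρ.range ∧ Nat.card ρ.range ≤ ∏ i, Nat.card (S i) := by
  let f : ρ.range → (∀ i, S i) := fun y i ↦ ⟨y.1 i, by obtain ⟨x, hx⟩ := y.2; rw [← hx]; exact hS x i⟩
  have hf : Function.Injective f := by
    intro a b hab
    apply Subtype.ext
    funext i
    have h := congrFun hab i
    exact congrArg Subtype.val h
  haveI : Finite (∀ i, S i) := Pi.finite
  refine ⟨Finite.of_injective f hf, ?_⟩
  calc Nat.card ρ.range ≤ Nat.card (∀ i, S i) := Nat.card_le_card_of_injective f hf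
    _ = ∏ i, Nat.card (S i) := Nat.card_pi

/-- `#(D / ker ρ) ≤ t^N` when every coordinate group has order `≤ t`. [folklore] -/
theorem natCard_quotient_ker_le_pow (ρ : D →+ (Fin N → Y)) (S : Fin N → AddSubgroup Y)
    (hS : ∀ x i, ρ x i ∈ S i) [∀ i, Finite (S i)] {t : ℕ} (ht : ∀ i, Nat.card (S i) ≤ t) :
    Finite (D ⧸ ρ.ker) ∧ Nat.card (D ⧸ ρ.ker) ≤ t ^ N := by
  obtain ⟨hfin, hle⟩ := natCard_range_le_prod_of_apply_mem ρ S hS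
  have e : D ⧸ ρ.ker ≃+ ρ.range := QuotientAddGroup.quotientKerEquivRange ρ
  haveI : Finite (D ⧸ ρ.ker) := Finite.of_equiv _ e.toEquiv.symm
  refine ⟨inferInstance, ?_⟩
  calc Nat.card (D ⧸ ρ.ker) = Nat.card ρ.range := Nat.card_congr e.toEquiv
    _ ≤ ∏ i, Nat.card (S i) := hle
    _ ≤ ∏ _i : Fin N, t := Finset.prod_le_prod' fun i _ ↦ ht i
    _ = t ^ N := by rw [Finset.prod_const, Finset.card_univ, Fintype.card_fin]

/-- **`#(D / F) ≤ t^N`** for a subgroup `F` containing `ker ρ` (`ρ x = 0 ⇒ x ∈ F`), where `ρ : D →+ (Fin N → Y)` has coordinates in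
subgroups of order `≤ t`: `D/F` is a quotient of `D / ker ρ ↪ ∏ S i`. [folklore] -/
theorem natCard_quotient_le_pow_of_ker_le (ρ : D →+ (Fin N → Y)) (S : Fin N → AddSubgroup Y)
    (hS : ∀ x i, ρ x i ∈ S i) [∀ i, Finite (S i)] {t : ℕ} (ht : ∀ i, Nat.card (S i) ≤ t)
    (F : AddSubgroup D) (hF : ∀ x, ρ x = 0 → x ∈ F) :
    Finite (D ⧸ F) ∧ Nat.card (D ⧸ F) ≤ t ^ N := by
  obtain ⟨hfin, hle⟩ := natCard_quotient_ker_le_pow ρ S hS ht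
  have hker : ρ.ker ≤ F := fun x hx ↦ hF x hx
  let π : D ⧸ ρ.ker →+ D ⧸ F := QuotientAddGroup.map ρ.ker F (AddMonoidHom.id D) hker
  have hπ : Function.Surjective π := by
    rintro ⟨x⟩
    exact ⟨QuotientAddGroup.mk x, rfl⟩
  haveI := hfin
  exact ⟨Finite.of_surjective π hπ, (Nat.card_le_card_of_surjective π hπ).trans hle⟩

/-- **Nested-subgroup form**: for subgroups `F ≤ D'` of an ambient group `G` and an additive `ρ : D' →+ (Fin N → Y)` with coordinates in
subgroups of order `≤ t` and `ρ x = 0 ⇒ (x : G) ∈ F`: `#(D' / F) ≤ t^N` (the index `[D' : F]` in the currency `F.addSubgroupOf D'`).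
[folklore] -/
theorem natCard_quotient_addSubgroupOf_le_pow {G : Type*} [AddCommGroup G] {D' F : AddSubgroup G}
    (ρ : D' →+ (Fin N → Y)) (S : Fin N → AddSubgroup Y) (hS : ∀ x i, ρ x i ∈ S i) [∀ i, Finite (S i)] {t : ℕ}
    (ht : ∀ i, Nat.card (S i) ≤ t) (hF : ∀ x : D', ρ x = 0 → (x : G) ∈ F) :
    Finite (D' ⧸ F.addSubgroupOf D') ∧ Nat.card (D' ⧸ F.addSubgroupOf D') ≤ t ^ N :=
  natCard_quotient_le_pow_of_ker_le ρ S hS ht (F.addSubgroupOf D') fun x hx ↦ AddSubgroup.mem_addSubgroupOf.mpr (hF x hx)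

end Summit.BirchSwinnertonDyer.BirchSwinnertonDyer.Theorems.UniversalToricDescentQuotientBoundByCoordinates
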